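import Summits.Ventures.PercRepro.RankLevelSetExplicitLin2KeyCube

/-!
# PercRepro — THE LEVEL-10 CUBE ROW OF C-025: THE KEY AT `p = 3 294` AND THE CONDITIONAL LEVEL STEP (p9, S4)

`proofs/SUBCLAIM-S4-p9.md` §S4.2⁗‴. The saturated row of record at level `10` is `p ≥ 8 710` (RankLevelSetExplicitLin2RowTen).
With p4's cube multiplicity the assembled inequality `(P_d)` holds, exactly evaluated, at EVERY core corank `11 ≤ d ≤ 1034`
from `p = 3 294` — and fails at `p = 3 293` (corank `629`, the big class's saturation corank):
the cube key `KeyC 10 3294 d` (RankLevelSetExplicitLin2KeyCube) is checked by the kernel at the 1 024 coranks (`decide`, 1 chunk of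
1 024), and `c025_level_succ_of_keyC_row` turns the row into the level step
**`c025_ten_cube_step (hprev : ∀ M p, 3 293 ≤ p → RLS M p 9) : ∀ M p, 3 294 ≤ p → RLS M p 10`** (`N₁(10) = 2 292`,
tail `2 103`). The unconditional rows are composed in RankLevelSetExplicitLin2CubeFloor. Axioms: standard.
-/

open scoped Matroid

namespace PercRepro

namespace ThmN

namespace Explicit

/-- **THE CUBE KEY ROW AT `(q, p) = (10, 3 294)`**: `KeyC 10 3294 d` at every corank `11 ≤ d ≤ 1034`, by the kernel. -/
theorem key_ten_cube_row : ∀ t < 1024, KeyC 10 3294 (11 + t) := by decide +kernel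

/-- **THE CUBE FLOOR IS EXACT**: the cube key FAILS at `p = 3 293`, corank `629` (the big class's saturation corank), by the kernel. -/
theorem key_ten_cube_sharp : ¬ KeyC 10 3293 629 := by decide +kernel

end Explicit

variable {α : Type}

/-- **THE LEVEL-10 CUBE STEP FROM `3 294`**: level `10` for every finite matroid and every `p ≥ 3 294` from level `9` for
every `p ≥ 3 293` — the cube key row at `3 294`, its monotonicity in `p`, and the wrapper `c025_level_succ_of_keyC_row`
(`N₁(10) = 2 292 ≤ 3 294`, tail `2 103 ≤ 3 294`). -/
theorem c025_ten_cube_step (hprev : ∀ (M : Matroid α) [M.Finite] (p : ℕ), 3293 ≤ p → RLS M p 9) :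
    ∀ (M : Matroid α) [M.Finite] (p : ℕ), 3294 ≤ p → RLS M p 10 :=
  c025_level_succ_of_keyC_row 9 (by norm_num) 3294 (by norm_num) (by norm_num) Explicit.key_ten_cube_row hprev

end ThmN

end PercRepro
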